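import Mathlib.Analysis.Real.Sqrt
import Mathlib.LinearAlgebra.Matrix.Trace
import Mathlib.Algebra.Order.Chebyshev
import Mathlib.Analysis.SpecialFunctions.Log.Basic
import HarnessLib

/-!
# Mirror benchmarking: the survival probability decays as `A f u^{L−1} + B` (Mayer et al. 2021, Lemma 1 / Theorem 1)

HONEST FRAMING (cell `pub-qadeq`, lane harvest-2): instance-level adjudication of specific
advantage claims; no claim about BQP vs BPP or the summit. This file is cited VOCABULARY for the
fidelity METRIC of the trapped-ion random-circuit-sampling rows of the lane's register — E-08
(DeCross et al. 2025: "the MB return probability … `F_MB`, serves as an estimate of the overall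
fidelity") and E-09 (Ransford et al. 2025: mirrored-RCS fidelity vs depth with the gate-counting fit
eq. (3)). Nothing here is asserted about any device, gate set or noise strength.

## Source and the printed argument

K. Mayer, A. Hall, T. Gatterman, S. K. Halit, K. Lee, J. Bohnet, D. Gresh, A. Hankin, K. Gilmore,
J. Gerber, J. Gaebler (Quantinuum), *Theory of mirror benchmarking and demonstration on a quantum
computer*, arXiv:2108.10431 (2021) [MayerEtAl2021]; held text `paper:arxiv-2108.10431`, locators
`pNNNN Lnn` refer to it.

§II (p0002–p0003). A sequence `g₁,…,g_L` from a group `G` "that forms a unitary 2-design",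
followed by the inverses, with "a constant error channel `𝓔` associated with each unitary", "`𝓔` is
unital", the error on the inversion half "given by `𝓔†`" (p0002 L9–24); survival probability
`p(L) = ⟨⟨E| T_L |ρ⟩⟩` (eq. (7)) with "`T₁ = 𝓔^T` and `T_{l+1} = (𝓔† T_l 𝓔)^T`" where `M^T` is the twirl
over `G` (eq. (3)). For a 2-design "the twirl of `M` over `G` is a linear combination of two
projectors: `M^T = aΠ₁ + bΠ₂` (8)", `Π₁`, `Π₂` the projectors onto `span{I}` and the traceless
operators, `a = 1` for trace-preserving `M` (9), "`b = (1/D) Tr(Π₂ M)` (10)", `D = d² − 1`;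
"`f(𝓔) = (1/D) Tr(Π₂𝓔)` (11)", "`1 − f(𝓔) = (d²/D)(1 − F(𝓔))` (12)" with `F` the process
(entanglement) fidelity, "`𝓔^T = Π₁ + fΠ₂` (13)", unitarity "`u = (1/D) Tr(Π₂𝓔†Π₂𝓔)` (14)".
**Lemma 1** (p0003 L15–48): "`T_l = Π₁ + f u^{l−1} Π₂`", by induction using "Since `𝓔` is trace
preserving, `Π₁𝓔Π₂ = 0`, from which it follows that `Tr(Π₂𝓔†Π₁𝓔) = Tr(𝓔†Π₁𝓔Π₂) = 0` (16)".
**Theorem 1** (p0003 L49–55): "`p(L) = A f u^{L−1} + B` (18), for constants `A` and `B` that depend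
only on the state prep and measurement", `A = ⟨⟨E|Π₂|ρ⟩⟩`, `B = ⟨⟨E|Π₁|ρ⟩⟩`. Comments (p0003 L70–95):
"In the limit of perfectly coherent errors, that is `u = 1`, the survival probability does not decay
at all"; "when the error is a depolarizing channel, `𝓔 = Π₁ + fΠ₂` and therefore `u = f²` and
`p(L) = A f^{2L−1} + B`. It is only in this special case that the decay parameter also extracts the
fidelity of `𝓔`. If `𝓔` is a stochastic Pauli channel … `𝓔 = 𝓔†` is diagonal in the Pauli basis …
The process fidelity then is bounded in terms of the unitarity according to
`(1/d²)(1 + D u) ≤ F(𝓔) ≤ (1/d²)(1 + D√u)` (19)". Appendix B (p0006 L96–p0007):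
"`u = (1/D) Σ_{i,j>0} 𝓔_{ij}² ≥ (1/D) Σ_{i>0} 𝓔_{ii}²` (B1). The latter inequality is saturated when
`𝓔` is a stochastic Pauli channel", "`F(𝓔) = (1/d²)(1 + Σ_{i>0} 𝓔_{ii})` (B2)", "since each
`𝓔_{ii} ∈ [0,1]`, `Σ_{i>0} 𝓔_{ii}² ≤ Σ_{i>0} 𝓔_{ii}` (B3)".

## How it is typed (and what is an INPUT, not proved)

Superoperators are real matrices `Matrix ι ι ℝ` on a finite operator-basis index `ι` (for `n`
qubits: the `4ⁿ = d²` Pauli labels, the Pauli-transfer-matrix picture of Appendix B, in which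
`𝓔† ↦ 𝓔ᵀ`), with a distinguished label `o : ι` for the identity operator; `Π₁ = |o⟩⟨o|`
(`proj1 o`), `Π₂ = 1 − Π₁` (`proj2 o`), `D = |ι| − 1` (`dimD`). Trace preservation and unitality
of `𝓔` are the row/column conditions `𝓔_{o,j} = δ_{oj}`, `𝓔_{i,o} = δ_{io}` (`IsTPUnital`). The
2-DESIGN TWIRL IS TAKEN IN ITS PRINTED CLOSED FORM (8)–(10): `designTwirl o M :=
M_{oo}·Π₁ + ((Tr M − M_{oo})/D)·Π₂` (note `Tr(Π₁M) = M_{oo}`, `Tr(Π₂M) = Tr M − M_{oo}`). That the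
average `(1/|G|) Σ_g g⁻¹Mg` over a unitary 2-design EQUALS this expression is the representation-
theoretic input the source cites from Dankert–Cleve–Emerson–Livine 2009 / Nielsen 2002 ([10], [11]
there) and is NOT formalised here; everything downstream of (8)–(10) — Lemma 1, Theorem 1, the
depolarizing and stochastic-Pauli specialisations, (B1)–(B3), (19), (12) — is proved.

## Contents (all proved; 0 named facts, 0 `sorry`)

* `proj1`, `proj2`, `dimD`, `IsTPUnital`, `fParam` (`f`, eq. (11)), `unitarity` (`u`, eq. (14) in the
  form (B1)), `processFidelity` (`F = Tr 𝓔/d²`, eq. (B2)), `designTwirl` (eqs. (8)–(10)),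
  `mirrorT o 𝓔 l` (= the printed `T_{l+1}`), `survival meas ρ 𝓔 l` (= the printed `p(l+1)`).
* `designTwirl_eq_of_isTPUnital` — eq. (13): `𝓔^T = Π₁ + f Π₂`.
* `conj_apply_oo`, `trace_conj_sub` — the two scalars of the induction step:
  `(𝓔ᵀ(Π₁ + cΠ₂)𝓔)_{oo} = 1` and `Tr(𝓔ᵀ(Π₁ + cΠ₂)𝓔) − 1 = c·D·u` (eqs. (15)–(17), using (16)).
* **`mirrorT_eq`** — Lemma 1: `T_{l+1} = Π₁ + f u^l Π₂`.
* **`survival_eq`** — Theorem 1: `p(l+1) = A·f·u^l + B`, `A = ⟨meas, Π₂ρ⟩`, `B = ⟨meas, Π₁ρ⟩`;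
  `survival_eq_of_unitarity_eq_one` (no decay at `u = 1`).
* Depolarizing channel `Π₁ + fΠ₂`: `isTPUnital_depol`, `fParam_depol`, `unitarity_depol` (`u = f²`),
  **`survival_depol`** (`p(l+1) = A f^{2l+1} + B`, the printed `A f^{2L−1} + B`).
* Stochastic Pauli channel `diagonal λ` (`λ_o = 1`): `unitarity_diagonal` ((B1) saturated),
  `fParam_diagonal`, `processFidelity_diagonal` ((B2)), and **`processFidelity_bounds_diagonal`** —
  eq. (19) under the printed hypothesis `λ_i ∈ [0,1]`.
* General channel: `unitarity_ge_diag_sq` ((B1)), `one_sub_fParam_eq` (eq. (12):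
  `1 − f = (d²/D)(1 − F)` whenever `𝓔_{oo} = 1`).
* The gate-counting companions used by E-08/E-09 (DeCross et al. 2025 eqs. (10)–(11); Ransford et
  al. 2025 eq. (3)): `avgToProcess d ε = ((d+1)/d)·ε` with the printed prefactors `5/4` (d = 4) and
  `3/2` (d = 2), `effInfidelity` (eq. (10)), `gateCountFidelity` (eq. (11)) with
  `log_gateCountFidelity` (log-linear in the gate count) and `gateCountFidelity_anti` (more gates,
  lower model fidelity).

## What is NOT here (stated, not formalised)

The 2-design identity behind `designTwirl` (above); the reduction (1)→(2)→(7) of the group average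
to the recursion (eqs. (4)–(6), which use the group structure); the non-unital relaxation of
Appendix A; §III (generating sets vs. exact 2-designs, frame potentials); the statistics of
estimating `u` from finitely many sequences; Nielsen's Haar-average formula relating average gate
fidelity to process fidelity (only the conversion arithmetic `(d+1)/d` that E-08/E-09 print is
typed); Ransford et al.'s boundary-depth shift `δ = 1.12` (a fitted constant); anything about a
particular device.

## Why the lane holds it (E-links; quotations from the lane's own materialisations)

* E-08 (DeCross et al., PRX 15, 021052 (2025) = arXiv:2406.02501 [DeCrossEtAl2025]) p0011 L53–68:
  "Our primary tool for fidelity estimation is a mirror-benchmarking (MB) technique similar to that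
  described in Refs. [38, 39] … Randomized compiling [40] is used on the mirrored half of the
  circuit to prevent the potential cancellation of coherent errors … The fraction of samples in
  which the qubits all return to the expected state, referred to as the MB return probability and
  denoted `F_MB`, serves as an estimate of the overall fidelity of the output state for a depth-`d`
  circuit" ([38] = the source above); p0012 L39–58: "`ε(N) = (5/4)ε_2Q + 2 × (3/2)ε_mem(N)` (10),
  where the prefactors incorporate the conversion between average and process fidelities [42] as
  well as the fact that there are two qubits in each 2Q gate", "`F_GC(N,d) = (1 − ε(N))^{Nd/2}
  (1 − p_SPAM)^N` (11)".
* E-09 (Ransford et al., arXiv:2511.05465 [RansfordEtAl2025]) p0012 L97–103: "infer the fidelity of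
  a layer depth-`l` circuit by computing the return-probability `F_MB` of a “mirrored” layer
  depth-`l/2` circuit, with the second (mirrored) half of the circuit employing randomized compiling
  to prevent unintended cancellation of coherent errors"; p0013 L72–80: "least-squares best fit to
  the gate-counting model from [3], `F_GC(l) = (1 − p_spam)^N (1 − (5/4)ε_eff,2Q)^{(N/2)(l−δ)}` (3)".
  Why randomized compiling matters is exactly the source's `u = 1` remark
  (`survival_eq_of_unitarity_eq_one`) versus `survival_depol`.

## References

* [MayerEtAl2021] K. Mayer et al., arXiv:2108.10431 (2021), §II, Lemma 1, Theorem 1, App. B.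
* [DeCrossEtAl2025] M. DeCross et al., Phys. Rev. X 15, 021052 (2025), §IV eqs. (10)–(11).
* [RansfordEtAl2025] A. Ransford et al., arXiv:2511.05465 (2025), §V B 2 eq. (3).
-/

noncomputable section

open Finset Matrix

namespace Literature.InformationTheory.QuantumLearning

namespace MirrorRB

variable {ι : Type*} [Fintype ι] [DecidableEq ι]

/-! ### The two projectors and the channel parameters -/

/-- `Π₁`: the projector onto `span{I}` — in an operator basis indexed by `ι` whose label `o` is the
identity operator, the matrix unit at `(o, o)`. [cite: MayerEtAl2021, §II p0002 L100–110] -/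
def proj1 (o : ι) : Matrix ι ι ℝ := of fun i j => if i = o ∧ j = o then 1 else 0

/-- `Π₂ = 1 − Π₁`: the projector onto the traceless operators.
[cite: MayerEtAl2021, §II p0002 L100–110] -/
def proj2 (o : ι) : Matrix ι ι ℝ := 1 - proj1 o

/-- `D = dim V₂ = d² − 1` (here `|ι| − 1`, `|ι| = d²` operator-basis labels).
[cite: MayerEtAl2021, §II p0002 L114] -/
def dimD (ι : Type*) [Fintype ι] : ℝ := (Fintype.card ι : ℝ) - 1

omit [DecidableEq ι] in
/-- Unfolding `dimD`. [cite: MayerEtAl2021, §II p0002 L114] -/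
theorem dimD_eq : dimD ι = (Fintype.card ι : ℝ) - 1 := rfl

omit [Fintype ι] in
/-- Entry formula of `Π₁`. [cite: MayerEtAl2021, §II p0002 L100–110] -/
theorem proj1_apply (o i j : ι) : proj1 o i j = if i = o ∧ j = o then 1 else 0 := rfl

omit [Fintype ι] in
/-- Entry formula of `Π₂`. [cite: MayerEtAl2021, §II p0002 L100–110] -/
theorem proj2_apply (o i j : ι) :
    proj2 o i j = (if i = j then 1 else 0) - if i = o ∧ j = o then 1 else 0 := by
  rw [proj2, Matrix.sub_apply, Matrix.one_apply, proj1_apply]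

omit [Fintype ι] in
/-- `Π₁ + Π₂ = 1`. [cite: MayerEtAl2021, §II p0002 L102–104 ("`B(H) = V₁ ⊕ V₂`")] -/
theorem proj1_add_proj2 (o : ι) : proj1 o + proj2 o = 1 := by
  rw [proj2, add_sub_cancel]

/-- Trace preservation and unitality of an error channel `𝓔` in the transfer-matrix picture: the
`o`-row and the `o`-column are the unit vector `e_o` ("We assume that `𝓔` is unital"; "Since `𝓔` is
trace preserving, `Π₁𝓔Π₂ = 0`"). [cite: MayerEtAl2021, §II p0002 L13–16 and p0003 L30–31] -/
structure IsTPUnital (o : ι) (E : Matrix ι ι ℝ) : Prop where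
  row : ∀ j, E o j = if j = o then 1 else 0
  col : ∀ i, E i o = if i = o then 1 else 0

/-- `f(𝓔) = (1/D) Tr(Π₂𝓔) = (1/D) Σ_{i ≠ o} 𝓔_{ii}`. [cite: MayerEtAl2021, §II eq. (11) p0002 L131–134] -/
def fParam (o : ι) (E : Matrix ι ι ℝ) : ℝ := (∑ i ∈ univ.erase o, E i i) / dimD ι

/-- The unitarity `u = (1/D) Tr(Π₂𝓔†Π₂𝓔) = (1/D) Σ_{i,j ≠ o} 𝓔_{ij}²` (transfer-matrix form (B1)).
[cite: MayerEtAl2021, §II eq. (14) p0003 L5–12 and App. B eq. (B1) p0006 L100–112] -/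
def unitarity (o : ι) (E : Matrix ι ι ℝ) : ℝ :=
  (∑ i ∈ univ.erase o, ∑ j ∈ univ.erase o, E i j ^ 2) / dimD ι

/-- The process (entanglement) fidelity with the identity, `F(𝓔) = Tr(𝓔)/d²` (= `(1/d²)(1 +
Σ_{i>0} 𝓔_{ii})` when `𝓔_{oo} = 1`, eq. (B2)). [cite: MayerEtAl2021, App. B eq. (B2) p0006 L114–123] -/
def processFidelity (E : Matrix ι ι ℝ) : ℝ := Matrix.trace E / Fintype.card ι

omit [DecidableEq ι] in
/-- Unfolding `processFidelity`. [cite: MayerEtAl2021, App. B eq. (B2) p0006 L114–123] -/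
theorem processFidelity_eq (E : Matrix ι ι ℝ) :
    processFidelity E = Matrix.trace E / Fintype.card ι := rfl

/-- The trace splits as the `o`-diagonal entry plus the rest. [folklore] -/
private theorem trace_eq_add_sum_erase (o : ι) (E : Matrix ι ι ℝ) :
    Matrix.trace E = E o o + ∑ i ∈ univ.erase o, E i i := by
  rw [Matrix.trace, ← Finset.add_sum_erase _ _ (mem_univ o)]
  rfl

/-- (B2) as printed: `F(𝓔) = (1/d²)(1 + Σ_{i ≠ o} 𝓔_{ii})` when `𝓔_{oo} = 1`.
[cite: MayerEtAl2021, App. B eq. (B2) p0006 L114–123] -/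
theorem processFidelity_eq_of_apply_oo {o : ι} {E : Matrix ι ι ℝ} (h : E o o = 1) :
    processFidelity E = (1 + ∑ i ∈ univ.erase o, E i i) / Fintype.card ι := by
  rw [processFidelity_eq, trace_eq_add_sum_erase o, h]

/-- Eq. (12): `1 − f(𝓔) = (d²/D)(1 − F(𝓔))` whenever `𝓔_{oo} = 1` (e.g. `𝓔` trace preserving) and
`d² > 1`. [cite: MayerEtAl2021, §II eq. (12) p0002 L135–143] -/
theorem one_sub_fParam_eq {o : ι} {E : Matrix ι ι ℝ} (h : E o o = 1)
    (hD : 1 < Fintype.card ι) :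
    1 - fParam o E = (Fintype.card ι : ℝ) / dimD ι * (1 - processFidelity E) := by
  have hcard : (0 : ℝ) < Fintype.card ι := by exact_mod_cast (zero_lt_one.trans hD)
  have hDpos : 0 < dimD ι := by
    rw [dimD_eq]
    have : (1 : ℝ) < Fintype.card ι := by exact_mod_cast hD
    linarith
  rw [fParam, processFidelity_eq_of_apply_oo h, dimD_eq] at *
  field_simp
  ring

/-! ### The 2-design twirl in its printed closed form, and the recursion `T_l` -/

/-- The twirl over a unitary 2-design in the closed form of eqs. (8)–(10): `M^T = aΠ₁ + bΠ₂` with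
`a = Tr(Π₁M) = M_{oo}` (`= 1` for trace-preserving `M`, eq. (9)) and `b = (1/D) Tr(Π₂M) =
(Tr M − M_{oo})/D`. That the group average `(1/|G|) Σ_g g⁻¹ M g` equals this is the 2-design input
([10], [11] of the source), taken here as the definition.
[cite: MayerEtAl2021, §II eqs. (8)–(10) p0002 L99–131] -/
def designTwirl (o : ι) (M : Matrix ι ι ℝ) : Matrix ι ι ℝ :=
  M o o • proj1 o + ((Matrix.trace M - M o o) / dimD ι) • proj2 o

/-- Unfolding `designTwirl`. [cite: MayerEtAl2021, §II eqs. (8)–(10) p0002 L99–131] -/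
theorem designTwirl_eq (o : ι) (M : Matrix ι ι ℝ) :
    designTwirl o M = M o o • proj1 o + ((Matrix.trace M - M o o) / dimD ι) • proj2 o := rfl

/-- Eq. (13): for a trace-preserving unital channel, `𝓔^T = Π₁ + f Π₂`.
[cite: MayerEtAl2021, §II eq. (13) p0003 L2–4] -/
theorem designTwirl_eq_of_isTPUnital {o : ι} {E : Matrix ι ι ℝ} (hE : IsTPUnital o E) :
    designTwirl o E = proj1 o + fParam o E • proj2 o := by
  have hoo : E o o = 1 := by rw [hE.row o, if_pos rfl]
  rw [designTwirl_eq, hoo, one_smul, fParam, trace_eq_add_sum_erase o, hoo, add_sub_cancel_left]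

/-- The recursion of eq. (7)/Lemma 1: `mirrorT o 𝓔 0 = 𝓔^T` (the printed `T₁`) and
`mirrorT o 𝓔 (l+1) = (𝓔† (mirrorT o 𝓔 l) 𝓔)^T` (the printed `T_{l+2}`; `𝓔† = 𝓔ᵀ` in the real
transfer-matrix picture). So `mirrorT o 𝓔 l` is the printed `T_{l+1}`.
[cite: MayerEtAl2021, §II p0002 L93–98 and Lemma 1 p0003 L15–16] -/
def mirrorT (o : ι) (E : Matrix ι ι ℝ) : ℕ → Matrix ι ι ℝ
  | 0 => designTwirl o E
  | l + 1 => designTwirl o (Eᵀ * mirrorT o E l * E)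

/-- `mirrorT` at `0`. [cite: MayerEtAl2021, Lemma 1 p0003 L15–16] -/
theorem mirrorT_zero (o : ι) (E : Matrix ι ι ℝ) : mirrorT o E 0 = designTwirl o E := rfl

/-- `mirrorT` successor step. [cite: MayerEtAl2021, Lemma 1 p0003 L15–16] -/
theorem mirrorT_succ (o : ι) (E : Matrix ι ι ℝ) (l : ℕ) :
    mirrorT o E (l + 1) = designTwirl o (Eᵀ * mirrorT o E l * E) := rfl

/-! ### The two scalars of the induction step (eqs. (15)–(17)) -/

/-- `(𝓔ᵀ Π₁ 𝓔)_{ij} = 𝓔_{oi} 𝓔_{oj}`. [folklore] -/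
private theorem transpose_mul_proj1_mul_apply (o : ι) (E : Matrix ι ι ℝ) (i j : ι) :
    (Eᵀ * proj1 o * E) i j = E o i * E o j := by
  rw [Matrix.mul_apply]
  have h1 : ∀ k, (Eᵀ * proj1 o) i k = if k = o then E o i else 0 := by
    intro k
    rw [Matrix.mul_apply]
    simp only [transpose_apply, proj1_apply, mul_ite, mul_one, mul_zero]
    by_cases hk : k = o
    · subst hk
      simp only [and_true, if_true]
      rw [Finset.sum_ite_eq' univ k (fun x => E x i)]
      simp
    · simp [hk]
  simp_rw [h1, ite_mul, zero_mul, Finset.sum_ite_eq' univ o, mem_univ, if_true]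

omit [DecidableEq ι] in
/-- `(𝓔ᵀ 𝓔)_{ij} = Σ_k 𝓔_{ki} 𝓔_{kj}`. [folklore] -/
private theorem transpose_mul_self_apply (E : Matrix ι ι ℝ) (i j : ι) :
    (Eᵀ * E) i j = ∑ k, E k i * E k j := by
  rw [Matrix.mul_apply]
  rfl

omit [Fintype ι] in
/-- `Π₁ + cΠ₂ = c·1 + (1 − c)·Π₁`. [folklore] -/
private theorem proj1_add_smul_proj2 (o : ι) (c : ℝ) :
    proj1 o + c • proj2 o = c • (1 : Matrix ι ι ℝ) + (1 - c) • proj1 o := by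
  rw [proj2, smul_sub]
  module

/-- Conjugating `Π₁ + cΠ₂` by a TP unital channel keeps the `(o,o)` entry equal to `1` (the `a = 1`
of eq. (9) in the induction step (15)). [cite: MayerEtAl2021, Lemma 1 proof eqs. (15)–(16) p0003 L19–40] -/
theorem conj_apply_oo {o : ι} {E : Matrix ι ι ℝ} (hE : IsTPUnital o E) (c : ℝ) :
    (Eᵀ * (proj1 o + c • proj2 o) * E) o o = 1 := by
  rw [proj1_add_smul_proj2, Matrix.mul_add, Matrix.add_mul, Matrix.mul_smul, Matrix.smul_mul,
    Matrix.mul_smul, Matrix.smul_mul, Matrix.mul_one, Matrix.add_apply, Matrix.smul_apply,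
    Matrix.smul_apply, smul_eq_mul, smul_eq_mul, transpose_mul_self_apply,
    transpose_mul_proj1_mul_apply]
  have hcol : ∀ k, E k o = if k = o then 1 else 0 := hE.col
  simp_rw [hcol]
  simp only [mul_ite, mul_one, mul_zero, Finset.sum_ite_eq' univ o, mem_univ, if_true]
  ring

/-- The Frobenius sum of a TP unital channel splits off exactly `1` from the `o`-row and `o`-column:
`Σ_{i,k} 𝓔_{ki}² = 1 + Σ_{i,k ≠ o} 𝓔_{ki}²`. [folklore] -/
private theorem sum_sq_eq_one_add {o : ι} {E : Matrix ι ι ℝ} (hE : IsTPUnital o E) :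
    ∑ i, ∑ k, E k i ^ 2 = 1 + ∑ i ∈ univ.erase o, ∑ k ∈ univ.erase o, E k i ^ 2 := by
  rw [← Finset.add_sum_erase _ _ (mem_univ o)]
  have h0 : ∑ k, E k o ^ 2 = 1 := by
    simp_rw [hE.col]
    simp only [ite_pow, one_pow, ne_eq, OfNat.ofNat_ne_zero, not_false_eq_true, zero_pow,
      Finset.sum_ite_eq' univ o, mem_univ, if_true]
  rw [h0]
  congr 1
  refine sum_congr rfl fun i hi => ?_
  rw [← Finset.add_sum_erase _ _ (mem_univ o)]
  have : E o i = 0 := by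
    rw [hE.row i, if_neg (ne_of_mem_erase hi)]
  rw [this]
  ring

/-- The trace of the conjugate minus its `(o,o)` entry is `c·D·u` — eq. (17), using
`Tr(Π₂𝓔†Π₁𝓔) = 0` (eq. (16)) and the definition (14) of the unitarity.
[cite: MayerEtAl2021, Lemma 1 proof eqs. (15)–(17) p0003 L19–48] -/
theorem trace_conj_sub {o : ι} {E : Matrix ι ι ℝ} (hE : IsTPUnital o E) (c : ℝ) :
    Matrix.trace (Eᵀ * (proj1 o + c • proj2 o) * E) - (Eᵀ * (proj1 o + c • proj2 o) * E) o o
      = c * (dimD ι * unitarity o E) := by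
  rw [conj_apply_oo hE]
  rw [proj1_add_smul_proj2, Matrix.mul_add, Matrix.add_mul, Matrix.mul_smul, Matrix.smul_mul,
    Matrix.mul_smul, Matrix.smul_mul, Matrix.mul_one, Matrix.trace_add, Matrix.trace_smul,
    Matrix.trace_smul, smul_eq_mul, smul_eq_mul]
  have htr1 : Matrix.trace (Eᵀ * proj1 o * E) = 1 := by
    simp only [Matrix.trace, Matrix.diag_apply, transpose_mul_proj1_mul_apply]
    simp_rw [hE.row]
    simp only [mul_ite, mul_one, mul_zero, Finset.sum_ite_eq' univ o, mem_univ, if_true]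
  have htr2 : Matrix.trace (Eᵀ * E) = ∑ i, ∑ k, E k i ^ 2 := by
    simp only [Matrix.trace, Matrix.diag_apply, transpose_mul_self_apply]
    refine sum_congr rfl fun i _ => sum_congr rfl fun k _ => ?_
    ring
  rw [htr1, htr2, sum_sq_eq_one_add hE]
  have hDu : dimD ι * unitarity o E = ∑ i ∈ univ.erase o, ∑ k ∈ univ.erase o, E k i ^ 2 := by
    rw [unitarity, Finset.sum_comm]
    rcases eq_or_ne (dimD ι) 0 with hD | hD
    · -- `D = 0`: the index type has one element, the double sum is empty
      have hcard : Fintype.card ι = 1 := by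
        have h1 : (Fintype.card ι : ℝ) = 1 := by rw [dimD_eq] at hD; linarith
        exact_mod_cast h1
      have hempty : univ.erase o = ∅ := by
        rw [← Finset.card_eq_zero, Finset.card_erase_of_mem (mem_univ o), card_univ, hcard]
      rw [hempty, Finset.sum_empty, hD, zero_mul]
    · rw [mul_div_cancel₀ _ hD]
  rw [hDu]
  ring

/-! ### Lemma 1 and Theorem 1 -/

/-- **Lemma 1.** `T_{l+1} = Π₁ + f u^l Π₂` for every `l` (the printed `T_l = Π₁ + f u^{l−1} Π₂`,
`l ≥ 1`). [cite: MayerEtAl2021, §II Lemma 1 p0003 L15–48] -/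
theorem mirrorT_eq {o : ι} {E : Matrix ι ι ℝ} (hE : IsTPUnital o E) (l : ℕ) :
    mirrorT o E l = proj1 o + (fParam o E * unitarity o E ^ l) • proj2 o := by
  induction l with
  | zero => rw [mirrorT_zero, designTwirl_eq_of_isTPUnital hE, pow_zero, mul_one]
  | succ l ih =>
      rw [mirrorT_succ, ih, designTwirl_eq, trace_conj_sub hE, conj_apply_oo hE, one_smul]
      congr 2
      rcases eq_or_ne (dimD ι) 0 with hD | hD
      · simp [hD, unitarity]
      · field_simp
        ring

/-- The survival probability of eq. (7), `p(L) = ⟨⟨E| T_L |ρ⟩⟩`, for the measurement effect `meas`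
and the initial state `ρ` written as vectors in the operator basis: `survival meas ρ 𝓔 l` is the
printed `p(l+1)`. [cite: MayerEtAl2021, §II eq. (7) p0002 L93–98] -/
def survival (meas ρ : ι → ℝ) (o : ι) (E : Matrix ι ι ℝ) (l : ℕ) : ℝ :=
  meas ⬝ᵥ (mirrorT o E l *ᵥ ρ)

/-- **Theorem 1.** `p(L) = A f u^{L−1} + B` with `A = ⟨⟨E|Π₂|ρ⟩⟩`, `B = ⟨⟨E|Π₁|ρ⟩⟩` "constants that
depend only on the state prep and measurement" (here `L = l + 1`).
[cite: MayerEtAl2021, §II Theorem 1 eq. (18) p0003 L49–55] -/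
theorem survival_eq {o : ι} {E : Matrix ι ι ℝ} (hE : IsTPUnital o E) (meas ρ : ι → ℝ) (l : ℕ) :
    survival meas ρ o E l
      = (meas ⬝ᵥ (proj2 o *ᵥ ρ)) * (fParam o E * unitarity o E ^ l) + meas ⬝ᵥ (proj1 o *ᵥ ρ) := by
  rw [survival, mirrorT_eq hE, Matrix.add_mulVec, Matrix.smul_mulVec, dotProduct_add,
    dotProduct_smul, smul_eq_mul]
  ring

/-- "In the limit of perfectly coherent errors, that is `u = 1`, the survival probability does not
decay at all." [cite: MayerEtAl2021, §II p0003 L70–74] -/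
theorem survival_eq_of_unitarity_eq_one {o : ι} {E : Matrix ι ι ℝ} (hE : IsTPUnital o E)
    (hu : unitarity o E = 1) (meas ρ : ι → ℝ) (l : ℕ) :
    survival meas ρ o E l = survival meas ρ o E 0 := by
  rw [survival_eq hE, survival_eq hE, hu, one_pow, pow_zero]

/-! ### The depolarizing channel: `u = f²`, `p(L) = A f^{2L−1} + B` -/

omit [Fintype ι] in
/-- The depolarizing channel `Π₁ + fΠ₂` is trace preserving and unital.
[cite: MayerEtAl2021, §II p0003 L74–76] -/
theorem isTPUnital_depol (o : ι) (f : ℝ) : IsTPUnital o (proj1 o + f • proj2 o) := by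
  refine ⟨fun j => ?_, fun i => ?_⟩
  · simp only [Matrix.add_apply, Matrix.smul_apply, proj1_apply, proj2_apply, smul_eq_mul,
      true_and]
    by_cases hj : j = o
    · subst hj; simp
    · simp [hj, Ne.symm hj]
  · simp only [Matrix.add_apply, Matrix.smul_apply, proj1_apply, proj2_apply, smul_eq_mul,
      and_true]
    by_cases hi : i = o
    · subst hi; simp
    · simp [hi]

/-- `f(Π₁ + fΠ₂) = f` (for `d² > 1`). [cite: MayerEtAl2021, §II eq. (13) p0003 L2–4] -/
theorem fParam_depol (o : ι) (f : ℝ) (hD : 1 < Fintype.card ι) :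
    fParam o (proj1 o + f • proj2 o) = f := by
  have hDne : dimD ι ≠ 0 := by
    rw [dimD_eq]
    have : (1 : ℝ) < Fintype.card ι := by exact_mod_cast hD
    linarith
  rw [fParam]
  have h : ∀ i ∈ univ.erase o, (proj1 o + f • proj2 o) i i = f := by
    intro i hi
    have hio : i ≠ o := ne_of_mem_erase hi
    simp [Matrix.add_apply, Matrix.smul_apply, proj1_apply, proj2_apply, hio]
  rw [Finset.sum_congr rfl h, Finset.sum_const, Finset.card_erase_of_mem (mem_univ o), card_univ,
    nsmul_eq_mul, Nat.cast_sub hD.le, Nat.cast_one, ← dimD_eq, mul_comm, mul_div_cancel_right₀ _ hDne]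

/-- "when the error is a depolarizing channel, `𝓔 = Π₁ + fΠ₂` and therefore `u = f²`" (for
`d² > 1`). [cite: MayerEtAl2021, §II p0003 L74–76] -/
theorem unitarity_depol (o : ι) (f : ℝ) (hD : 1 < Fintype.card ι) :
    unitarity o (proj1 o + f • proj2 o) = f ^ 2 := by
  have hDne : dimD ι ≠ 0 := by
    rw [dimD_eq]
    have : (1 : ℝ) < Fintype.card ι := by exact_mod_cast hD
    linarith
  rw [unitarity]
  have h : ∀ i ∈ univ.erase o, ∑ j ∈ univ.erase o, (proj1 o + f • proj2 o) i j ^ 2 = f ^ 2 := by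
    intro i hi
    have hio : i ≠ o := ne_of_mem_erase hi
    have hentry : ∀ j ∈ univ.erase o,
        (proj1 o + f • proj2 o) i j ^ 2 = if i = j then f ^ 2 else 0 := by
      intro j _
      by_cases hij : i = j
      · subst hij
        simp [Matrix.add_apply, Matrix.smul_apply, proj1_apply, proj2_apply, hio]
      · simp [Matrix.add_apply, Matrix.smul_apply, proj1_apply, proj2_apply, hio, hij]
    rw [Finset.sum_congr rfl hentry, Finset.sum_ite_eq (univ.erase o) i (fun _ => f ^ 2), if_pos hi]
  rw [Finset.sum_congr rfl h, Finset.sum_const, Finset.card_erase_of_mem (mem_univ o), card_univ,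
    nsmul_eq_mul, Nat.cast_sub hD.le, Nat.cast_one, ← dimD_eq, mul_comm, mul_div_cancel_right₀ _ hDne]

/-- **Depolarizing special case of Theorem 1**: `p(L) = A f^{2L−1} + B` (here `L = l + 1`, so the
exponent is `2l + 1`); "It is only in this special case that the decay parameter also extracts the
fidelity of `𝓔`". [cite: MayerEtAl2021, §II p0003 L74–78] -/
theorem survival_depol (o : ι) (f : ℝ) (hD : 1 < Fintype.card ι) (meas ρ : ι → ℝ) (l : ℕ) :
    survival meas ρ o (proj1 o + f • proj2 o) l
      = (meas ⬝ᵥ (proj2 o *ᵥ ρ)) * f ^ (2 * l + 1) + meas ⬝ᵥ (proj1 o *ᵥ ρ) := by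
  rw [survival_eq (isTPUnital_depol o f), fParam_depol o f hD, unitarity_depol o f hD, ← pow_mul,
    ← pow_succ']

/-! ### Stochastic Pauli channels (diagonal transfer matrices) and the bound (19) -/

/-- For a diagonal transfer matrix (a stochastic Pauli channel, "`𝓔 = 𝓔†` is diagonal in the Pauli
basis") the inequality (B1) is saturated: `u = (1/D) Σ_{i ≠ o} λ_i²`.
[cite: MayerEtAl2021, §II p0003 L78–83 and App. B eq. (B1) p0006 L100–114] -/
theorem unitarity_diagonal (o : ι) (lam : ι → ℝ) :
    unitarity o (diagonal lam) = (∑ i ∈ univ.erase o, lam i ^ 2) / dimD ι := by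
  rw [unitarity]
  congr 1
  refine sum_congr rfl fun i hi => ?_
  rw [Finset.sum_eq_single_of_mem i hi]
  · rw [diagonal_apply_eq]
  · intro j _ hji
    rw [diagonal_apply_ne _ (Ne.symm hji)]
    ring

/-- `f = (1/D) Σ_{i ≠ o} λ_i` for a diagonal transfer matrix.
[cite: MayerEtAl2021, §II eq. (11) p0002 L131–134] -/
theorem fParam_diagonal (o : ι) (lam : ι → ℝ) :
    fParam o (diagonal lam) = (∑ i ∈ univ.erase o, lam i) / dimD ι := by
  rw [fParam]
  simp only [diagonal_apply_eq]

/-- (B2) for a diagonal transfer matrix with `λ_o = 1`: `F = (1/d²)(1 + Σ_{i ≠ o} λ_i)`.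
[cite: MayerEtAl2021, App. B eq. (B2) p0006 L114–123] -/
theorem processFidelity_diagonal {o : ι} {lam : ι → ℝ} (h : lam o = 1) :
    processFidelity (diagonal lam) = (1 + ∑ i ∈ univ.erase o, lam i) / Fintype.card ι := by
  rw [processFidelity_eq_of_apply_oo (o := o) (by rw [diagonal_apply_eq, h])]
  simp only [diagonal_apply_eq]

/-- **Eq. (19)**: for a stochastic Pauli channel (diagonal transfer matrix, `λ_o = 1`) whose
diagonal entries lie in `[0, 1]` ("since each `𝓔_{ii} ∈ [0,1]`", App. B), the process fidelity is
pinned by the unitarity: `(1 + D u)/d² ≤ F ≤ (1 + D√u)/d²`.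
[cite: MayerEtAl2021, §II eq. (19) p0003 L83–96 and App. B (B1)–(B3) p0006 L96–133] -/
theorem processFidelity_bounds_diagonal {o : ι} {lam : ι → ℝ} (h : lam o = 1)
    (h0 : ∀ i, 0 ≤ lam i) (h1 : ∀ i, lam i ≤ 1) (hD : 1 < Fintype.card ι) :
    (1 + dimD ι * unitarity o (diagonal lam)) / Fintype.card ι ≤ processFidelity (diagonal lam) ∧
    processFidelity (diagonal lam) ≤
      (1 + dimD ι * Real.sqrt (unitarity o (diagonal lam))) / Fintype.card ι := by
  have hcard : (0 : ℝ) < Fintype.card ι := by exact_mod_cast (zero_lt_one.trans hD)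
  have hDpos : 0 < dimD ι := by
    rw [dimD_eq]
    have : (1 : ℝ) < Fintype.card ι := by exact_mod_cast hD
    linarith
  have hDcard : ((univ.erase o).card : ℝ) = dimD ι := by
    rw [Finset.card_erase_of_mem (mem_univ o), card_univ, Nat.cast_sub hD.le, Nat.cast_one, dimD_eq]
  set S := ∑ i ∈ univ.erase o, lam i with hS
  set Q := ∑ i ∈ univ.erase o, lam i ^ 2 with hQ
  have hSnn : 0 ≤ S := sum_nonneg fun i _ => h0 i
  have hQnn : 0 ≤ Q := sum_nonneg fun i _ => sq_nonneg _
  have hu : unitarity o (diagonal lam) = Q / dimD ι := unitarity_diagonal o lam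
  have hF : processFidelity (diagonal lam) = (1 + S) / Fintype.card ι := processFidelity_diagonal h
  rw [hu, hF, mul_div_cancel₀ _ hDpos.ne']
  constructor
  · -- (B3): `Σ λ² ≤ Σ λ` since each `λ ∈ [0,1]`
    have hQS : Q ≤ S := by
      rw [hQ, hS]
      refine sum_le_sum fun i _ => ?_
      nlinarith [h0 i, h1 i]
    gcongr
  · -- Cauchy–Schwarz: `(Σ λ)² ≤ D Σ λ²`, hence `Σ λ ≤ D √(Q/D)`
    have hCS : S ^ 2 ≤ dimD ι * Q := by
      rw [hS, hQ, ← hDcard]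
      exact sq_sum_le_card_mul_sum_sq
    have hS_le : S ≤ dimD ι * Real.sqrt (Q / dimD ι) := by
      have hrhs : dimD ι * Real.sqrt (Q / dimD ι) = Real.sqrt (dimD ι * Q) := by
        rw [show dimD ι * Q = dimD ι ^ 2 * (Q / dimD ι) by field_simp,
          Real.sqrt_mul (sq_nonneg _), Real.sqrt_sq hDpos.le]
      rw [hrhs]
      calc S = Real.sqrt (S ^ 2) := (Real.sqrt_sq hSnn).symm
        _ ≤ Real.sqrt (dimD ι * Q) := Real.sqrt_le_sqrt hCS
    gcongr

/-- (B1) in general: `u ≥ (1/D) Σ_{i ≠ o} 𝓔_{ii}²` (the diagonal terms are among the summands).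
[cite: MayerEtAl2021, App. B eq. (B1) p0006 L100–112] -/
theorem unitarity_ge_diag_sq (o : ι) (E : Matrix ι ι ℝ) (hD : 1 < Fintype.card ι) :
    (∑ i ∈ univ.erase o, E i i ^ 2) / dimD ι ≤ unitarity o E := by
  have hDpos : 0 < dimD ι := by
    rw [dimD_eq]
    have : (1 : ℝ) < Fintype.card ι := by exact_mod_cast hD
    linarith
  rw [unitarity]
  gcongr with i hi
  rw [← Finset.sum_erase_add _ _ hi]
  have : 0 ≤ ∑ j ∈ (univ.erase o).erase i, E i j ^ 2 := sum_nonneg fun j _ => sq_nonneg _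
  linarith

/-! ### Gate counting (the companions E-08 / E-09 print next to `F_MB`) -/

/-- The average-to-process infidelity conversion factor `(d+1)/d` ("the prefactors incorporate the
conversion between average and process fidelities"). The identity with Nielsen's Haar average is
not formalised; only the printed arithmetic is.
[cite: DeCrossEtAl2025, §IV eq. (10) p0012 L39–47] -/
def avgToProcess (d : ℕ) (ε : ℝ) : ℝ := ((d : ℝ) + 1) / d * ε

/-- `d = 4` (two qubits): the printed prefactor `5/4`.
[cite: DeCrossEtAl2025, §IV eq. (10) p0012 L39–47; RansfordEtAl2025, §V B 2 eq. (3) p0013 L72–80] -/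
theorem avgToProcess_four (ε : ℝ) : avgToProcess 4 ε = 5 / 4 * ε := by
  rw [avgToProcess]
  norm_num

/-- `d = 2` (one qubit): the printed prefactor `3/2`. [cite: DeCrossEtAl2025, §IV eq. (10) p0012 L39–47] -/
theorem avgToProcess_two (ε : ℝ) : avgToProcess 2 ε = 3 / 2 * ε := by
  rw [avgToProcess]
  norm_num

/-- Eq. (10) of DeCross et al.: the effective process infidelity per two-qubit gate,
`ε(N) = (5/4)ε_2Q + 2 × (3/2)ε_mem(N)`. [cite: DeCrossEtAl2025, §IV eq. (10) p0012 L39–47] -/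
def effInfidelity (ε2Q εmem : ℝ) : ℝ := avgToProcess 4 ε2Q + 2 * avgToProcess 2 εmem

/-- Eq. (10) unfolded. [cite: DeCrossEtAl2025, §IV eq. (10) p0012 L39–47] -/
theorem effInfidelity_eq (ε2Q εmem : ℝ) :
    effInfidelity ε2Q εmem = 5 / 4 * ε2Q + 2 * (3 / 2 * εmem) := by
  rw [effInfidelity, avgToProcess_four, avgToProcess_two]

/-- Eq. (11) of DeCross et al. (and eq. (3) of Ransford et al. without the depth shift `δ`): the
gate-counting model `F_GC = (1 − ε)^G (1 − p_SPAM)^N` for `G` two-qubit gates (`G = Nd/2` for `d`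
dense layers) and `N` qubits. [cite: DeCrossEtAl2025, §IV eq. (11) p0012 L48–58] -/
def gateCountFidelity (ε pSPAM : ℝ) (G N : ℕ) : ℝ := (1 - ε) ^ G * (1 - pSPAM) ^ N

/-- The model is log-linear in the gate count (why it is fitted on a log scale against depth).
[cite: DeCrossEtAl2025, §IV eq. (11) p0012 L48–58; RansfordEtAl2025, §V B 2 eq. (3) p0013 L72–80] -/
theorem log_gateCountFidelity {ε pSPAM : ℝ} (hε : ε < 1) (hp : pSPAM < 1) (G N : ℕ) :
    Real.log (gateCountFidelity ε pSPAM G N)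
      = G * Real.log (1 - ε) + N * Real.log (1 - pSPAM) := by
  rw [gateCountFidelity, Real.log_mul (pow_ne_zero _ (by linarith)) (pow_ne_zero _ (by linarith)),
    Real.log_pow, Real.log_pow]

/-- More gates, lower model fidelity (`0 ≤ ε ≤ 1`, `p_SPAM ≤ 1`).
[cite: DeCrossEtAl2025, §IV eq. (11) p0012 L48–58] -/
theorem gateCountFidelity_anti {ε pSPAM : ℝ} (hε0 : 0 ≤ ε) (hε1 : ε ≤ 1) (hp : pSPAM ≤ 1)
    {G G' : ℕ} (hGG' : G ≤ G') (N : ℕ) :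
    gateCountFidelity ε pSPAM G' N ≤ gateCountFidelity ε pSPAM G N := by
  unfold gateCountFidelity
  have h1 : (1 - ε) ^ G' ≤ (1 - ε) ^ G := pow_le_pow_of_le_one (by linarith) (by linarith) hGG'
  have h2 : 0 ≤ (1 - pSPAM) ^ N := pow_nonneg (by linarith) N
  exact mul_le_mul_of_nonneg_right h1 h2

end MirrorRB

end Literature.InformationTheory.QuantumLearning

end
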